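import Mathlib
import Summits.NavierStokesRegularity.FluidComputer.AbcInertiaCIBases
import Summits.NavierStokesRegularity.FluidComputer.AbcInertiaCIExactlyPairR500

/-!
# INERTIA-3L, CLASS I — «EXACTLY THE HOPF PAIR» IN ARBITRARY REAL ORTHONORMAL ORBIT BASES (R = 300 and R = 500)
# (instab3 g9, cell `ns-blowup`, 2026-08-27)

HONEST FRAMING (human rulings D-0035/D-0074): **MODEL linear operator, computer-assisted; not NS.** Nothing
here is a statement about Navier–Stokes regularity or blow-up. Object: the linearisation of forced NS about
`U = abcFlow 1 1 1` on the unit torus at viscosity `1/(2πR)`, `R ∈ {300, 500}`, symmetry CLASS I. bears_on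
LADDER-NS N1* T6 (contest-I at R 300; leader order at R 500) / profile W3. WHAT THIS IS NOT: not NS; no
certificate re-run; no number or census word moves.

`AbcInertiaCIExactlyPair` / `AbcInertiaCIExactlyPairR500` state the class-I INERTIA facts (R1)(R2) on the kernel's
coordinates `AbcClassI.amat`, i.e. in cert-3's EXISTENTIAL orbit bases `AbcClassI.bfam`, where no program computes.
With the class-I basis transfer `AbcInertiaCIBases.card_classI_eigenfunctions_le_of_inertia_certificate_of_bases`
(this session) the same sentences hold with (R1)(R2) stated in ANY family `e` of real orthonormal bases of the
class-I orbit spaces `AbcClassI.realSpace O` (basis families `bf`, first-order matrix `am`) — so the INERTIA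
certifiers' OWN bases qualify modulo the AUDIT-BASIS clause «per orbit of `|O|² ≤ (r_H+1)²`, the certifier's
vectors are transversal, class I, conjugate-symmetric, real-orthonormal and `AbcClassI.odim O` in number»,
exactly as for class II (`AbcInertiaExactlyOne`, `AbcInertiaExactlyOneTight`):
* **`R300I_exactly_pair_i3_of_bases`** (cell `(300, I, 43/200, 2; 26, 28)`, impl 1, cert d06cde2372d172d9, j269622),
* **`R300I_exactly_pair_i4_of_bases`** (cell `(300, I, 43/200, 2; 28, 29)`, impl 2, j269943),
* **`R500I_exactly_pair_i4_of_bases`** (cell `(500, I, 1/4, 2; 36, 37)`, impl 2, j274542; single implementation),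
each with the T2 row (`Row3001C` / `Row5001C`, implementation C, complex orbit bases `wf`, hypotheses VERBATIM
cert-3's classical-form theorems). What is NOT kernel: the rows' primary interval outputs and (R1)(R2) = the
programs' verified arithmetic; AUDIT-BASIS (now the SAME clause for class I as for class II).

Mathlib + the two files named; no new definitions; std axioms. [folklore]
-/

noncomputable section

open scoped BigOperators ComplexConjugate InnerProductSpace Matrix
open Finset Matrix MeasureTheory UnitAddTorus

namespace Summit.NavierStokesRegularity.FluidComputer.AbcInertiaCI

open Literature.Analysis.FunctionSpaces Literature.Analysis.FunctionSpaces.Torus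
open Literature.Analysis.FluidPDE
open Summit.NavierStokesRegularity.FluidComputer.AbcClassI
open Summit.NavierStokesRegularity.FluidComputer.AbcClassII (Fam crossForm Orbit onormSq extend)
open Summit.NavierStokesRegularity.FluidComputer.CertificateAbcSpectrum

section Row

variable (wf : AbcClassI.Idx → Fam)
variable (hws : ∀ i : AbcClassI.Idx, ∀ k ∉ i.1.1, wf i k = 0)
variable (hwt : ∀ (i : AbcClassI.Idx) (k : Fin 3 → ℤ), ∑ j : Fin 3, ((k j : ℤ) : ℂ) * wf i k j = 0)
variable (hwI : ∀ i : AbcClassI.Idx, IsClassI (wf i))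
variable (hwon : ∀ (O : Orbit) (a b : Fin (AbcClassI.odim O)),
  ∑ k ∈ O.1, (inner ℂ (wf ⟨O, a⟩ k) (wf ⟨O, b⟩ k) : ℂ) = if a = b then 1 else 0)
variable (amc : AbcClassI.Idx → AbcClassI.Idx → ℂ)
variable (hamc : ∀ i j : AbcClassI.Idx, amc i j =
  ∑ k ∈ i.1.1, (inner ℂ (wf i k) (Torus.lerayCoeff k (crossForm 1 1 1 (wf j) k)) : ℂ))
variable (e : ∀ O : Orbit, OrthonormalBasis (Fin (AbcClassI.odim O)) ℝ (AbcClassI.realSpace O.1))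
variable (bf : AbcClassI.Idx → Fam)
variable (hbf : ∀ i : AbcClassI.Idx, bf i = extend i.1.1 ((e i.1 i.2 : AbcClassI.realSpace i.1.1) : EuclideanSpace ℂ (↥i.1.1 × Fin 3)))
variable (am : AbcClassI.Idx → AbcClassI.Idx → ℝ)
variable (ham : ∀ i j : AbcClassI.Idx, am i j =
  (∑ k ∈ i.1.1, (inner ℂ (bf i k) (Torus.lerayCoeff k (crossForm 1 1 1 (bf j) k)) : ℂ)).re)

include hws hwt hwI hwon hamc hbf ham in
/-- **R = 300, CLASS I: EXACTLY THE HOPF PAIR, (R1)(R2) IN ARBITRARY REAL ORTHONORMAL ORBIT BASES `e` — IMPLEMENTATION 1's cell `(300, I, 43/200, 2; 26, 28)`** (the T2 row `Row3001C` in the complex orbit bases `wf`). MODEL; conditional on the two certifier audits and AUDIT-BASIS. -/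
theorem R300I_exactly_pair_i3_of_bases
    (vt : AbcClassI.Idx → ℂ) (hvt0 : ∀ i, i ∉ AbcClassI.cubeIdx 96 → vt i = 0)
    (hres : ∑ i ∈ AbcClassI.cubeIdx 96 ∪ (AbcClassI.cubeIdx 96).biUnion AbcClassI.nbrIdx,
      ‖(if i ∈ AbcClassI.cubeIdx 96 then (((((Row3001C.lamRe : ℚ) : ℝ) : ℂ) + (((Row3001C.lamIm : ℚ) : ℝ) : ℂ) * Complex.I) - ((-(onormSq i.1 / 300) : ℝ) : ℂ)) * vt i
          else 0) - ∑ j ∈ AbcClassI.cubeIdx 96, amc i j * vt j‖ ^ 2 ≤ ((Row3001C.rnorm : ℚ) : ℝ) ^ 2)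
    (hntb : ∑ i ∈ AbcClassI.cubeIdx 96 \ AbcClassI.cubeIdx 22, ‖vt i‖ ^ 2 ≤
      (((2315674124931519 : ℚ) / 288230376151711744 : ℚ) : ℝ) ^ 2)
    (Binv : ((↥(AbcClassI.cubeIdx 22) → ℂ) × ℂ) →ₗ[ℂ] ((↥(AbcClassI.cubeIdx 22) → ℂ) × ℂ))
    (hBinv : ∀ (c : ↥(AbcClassI.cubeIdx 22) → ℂ) (m : ℂ),
      Binv (fun i : ↥(AbcClassI.cubeIdx 22) =>
          (((((Row3001C.lamRe : ℚ) : ℝ) : ℂ) + (((Row3001C.lamIm : ℚ) : ℝ) : ℂ) * Complex.I) - ((-(onormSq i.1.1 / 300) : ℝ) : ℂ)) * c i -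
          ∑ j : ↥(AbcClassI.cubeIdx 22), amc i j * c j + m * vt i,
        ∑ i : ↥(AbcClassI.cubeIdx 22), conj (vt i) * c i) = (c, m))
    (hαM : ∀ (c : ↥(AbcClassI.cubeIdx 22) → ℂ) (g : ℂ),
      ∑ j : ↥(AbcClassI.cubeIdx 22), ‖(Binv (c, g)).1 j‖ ^ 2 + ‖(Binv (c, g)).2‖ ^ 2 ≤
        ((Row3001C.alpha0 : ℚ) : ℝ) ^ 2 * (∑ i : ↥(AbcClassI.cubeIdx 22), ‖c i‖ ^ 2 + ‖g‖ ^ 2))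
    (hβBM : ∀ w : AbcClassI.Idx → ℂ,
      ∑ j : ↥(AbcClassI.cubeIdx 22), ‖(Binv (fun i : ↥(AbcClassI.cubeIdx 22) => -∑ j ∈ AbcClassI.nbrIdx i \ AbcClassI.cubeIdx 22,
          amc i j * w j, 0)).1 j‖ ^ 2 +
        ‖(Binv (fun i : ↥(AbcClassI.cubeIdx 22) => -∑ j ∈ AbcClassI.nbrIdx i \ AbcClassI.cubeIdx 22,
          amc i j * w j, 0)).2‖ ^ 2 ≤
        ((Row3001C.betaB : ℚ) : ℝ) ^ 2 * ∑ j ∈ (AbcClassI.cubeIdx 22).biUnion AbcClassI.nbrIdx \ AbcClassI.cubeIdx 22, ‖w j‖ ^ 2)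
    (hβCM : ∀ (c : ↥(AbcClassI.cubeIdx 22) → ℂ) (g : ℂ),
      ∑ i ∈ ((AbcClassI.cubeIdx 22).biUnion AbcClassI.nbrIdx ∪ AbcClassI.cubeIdx 96) \ AbcClassI.cubeIdx 22,
        ‖-∑ j : ↥(AbcClassI.cubeIdx 22), amc i j * (Binv (c, g)).1 j +
          (Binv (c, g)).2 * vt i‖ ^ 2 ≤
        ((Row3001C.betaC : ℚ) : ℝ) ^ 2 * (∑ i : ↥(AbcClassI.cubeIdx 22), ‖c i‖ ^ 2 + ‖g‖ ^ 2))
    (hgBM : ∀ w : AbcClassI.Idx → ℂ,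
      ‖(Binv (fun i : ↥(AbcClassI.cubeIdx 22) => ∑ j ∈ AbcClassI.nbrIdx i \ AbcClassI.cubeIdx 22,
          amc i j * w j, 0)).2‖ ^ 2 ≤
        (((2617195581838679 : ℚ) / 2251799813685248 : ℚ) : ℝ) ^ 2 *
          ∑ j ∈ (AbcClassI.cubeIdx 22).biUnion AbcClassI.nbrIdx \ AbcClassI.cubeIdx 22, ‖w j‖ ^ 2)
    (hshellM : ∀ w : AbcClassI.Idx → ℂ, (∀ i ∈ AbcClassI.cubeIdx 22, w i = 0) →
      (((5524214073445137 : ℚ) / 9007199254740992 : ℚ) : ℝ) * ∑ i ∈ AbcClassI.cubeIdx (22 + 1) \ AbcClassI.cubeIdx 22, ‖w i‖ ^ 2 ≤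
        ∑ i ∈ AbcClassI.cubeIdx (22 + 1) \ AbcClassI.cubeIdx 22,
          (((((Row3001C.lamRe : ℚ) : ℝ) : ℂ) + (((Row3001C.lamIm : ℚ) : ℝ) : ℂ) * Complex.I).re - (-(onormSq i.1 / 300)) - Real.sqrt 2) * ‖w i‖ ^ 2 -
        RCLike.re (∑ i ∈ (AbcClassI.cubeIdx 22).biUnion AbcClassI.nbrIdx \ AbcClassI.cubeIdx 22,
          conj (∑ j : ↥(AbcClassI.cubeIdx 22), amc i j *
            (Binv (fun i : ↥(AbcClassI.cubeIdx 22) => ∑ j ∈ AbcClassI.nbrIdx i \ AbcClassI.cubeIdx 22,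
              amc i j * w j, 0)).1 j) * w i))
    {HL HH HB : Finset AbcClassI.Idx}
    (hHL : ∀ i : AbcClassI.Idx, i ∈ HL ↔ onormSq i.1 ≤ (26 : ℝ) ^ 2)
    (hHH : ∀ i : AbcClassI.Idx, i ∈ HH ↔ onormSq i.1 ≤ (28 : ℝ) ^ 2)
    (hHB : ∀ i : AbcClassI.Idx, i ∈ HB ↔ (28 : ℝ) ^ 2 < onormSq i.1 ∧ onormSq i.1 ≤ ((28 : ℝ) + 1) ^ 2)
    (GH' Ah' : Matrix ↥HH ↥HH ℝ) (AHB' : Matrix ↥HH ↥HB ℝ) (ABH' : Matrix ↥HB ↥HH ℝ) (E : ↥HB → ℝ)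
    (V' : Matrix ↥HH (Fin 2) ℝ) (hGH' : GH'ᵀ = GH')
    (hAh' : Ah' = Matrix.of fun i j : ↥HH =>
      (if i = j then -(onormSq i.1.1 / (300 : ℝ)) - (43 / 200 : ℝ) else 0) + am i.1 j.1)
    (hAHB' : AHB' = Matrix.of fun (i : ↥HH) (l : ↥HB) => am i.1 l.1)
    (hABH' : ABH' = Matrix.of fun (l : ↥HB) (i : ↥HH) => am l.1 i.1)
    (hE : E = fun l : ↥HB => onormSq l.1.1 / (300 : ℝ) + (43 / 200 : ℝ) - Real.sqrt 2)
    (hR1' : ∀ x : ↥HH → ℝ, x ≠ 0 →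
      x ⬝ᵥ ((GH' * Ah' + Ah'ᵀ * GH' + (1 / 2 : ℝ) • ((GH' * AHB' + ABH'ᵀ) * Matrix.diagonal (fun l => (E l)⁻¹) *
        (GH' * AHB' + ABH'ᵀ)ᵀ)) *ᵥ x) < 0)
    (hR2' : ∀ x : ↥HH → ℝ, 0 ≤ x ⬝ᵥ ((GH' + V' * V'ᵀ) *ᵥ x)) :
    ∃ lam : ℂ, ‖lam - ((((Row3001C.lamRe : ℚ) : ℝ) : ℂ) + (((Row3001C.lamIm : ℚ) : ℝ) : ℂ) * Complex.I)‖ ≤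
        ((Row3001C.rho : ℚ) : ℝ) ∧ ((Row3001C.lamRe : ℚ) : ℝ) - ((Row3001C.rho : ℚ) : ℝ) ≤ lam.re ∧ 0 < lam.im ∧
      (∃ u : UnitAddTorus (Fin 3) → EuclideanSpace ℂ (Fin 3),
        Torus.LinNSResolventRel (1 / (2 * Real.pi * 300)) (Torus.abcFlow 1 1 1) (2 * Real.pi * lam) u 0 ∧
          u ≠ 0 ∧ IsClassI (mFourierCoeff u)) ∧
      (∃ u : UnitAddTorus (Fin 3) → EuclideanSpace ℂ (Fin 3),
        Torus.LinNSResolventRel (1 / (2 * Real.pi * 300)) (Torus.abcFlow 1 1 1) (2 * Real.pi * conj lam) u 0 ∧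
          u ≠ 0 ∧ IsClassI (mFourierCoeff u)) ∧
      ∀ (z : ℂ) (u : UnitAddTorus (Fin 3) → EuclideanSpace ℂ (Fin 3)),
        Torus.LinNSResolventRel (1 / (2 * Real.pi * 300)) (Torus.abcFlow 1 1 1) (2 * Real.pi * z) u 0 → u ≠ 0 →
          IsClassI (mFourierCoeff u) → (43 / 200 : ℝ) ≤ z.re → z = lam ∨ z = conj lam := by
  obtain ⟨lam, hclose, hrelo, -, him, hpair, hpairc, -, -⟩ :=
    AbcClassIEigenpair.row3001C_classI_eigenpairs_of_complex_bases wf hws hwt hwI hwon amc hamc vt hvt0 hres hntb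
      Binv hBinv hαM hβBM hβCM hgBM hshellM
  exact exactly_pair_of_row_of_cell (a := 43 / 200) a_le_row3001C
    (fun z hz u hu hu0 hI hre =>
      card_classI_eigenfunctions_le_of_inertia_certificate_of_bases e bf hbf am ham (R := 300) (a := 43 / 200)
        (rL := 26) (rH := 28) (m := 2) (by norm_num) (by norm_num) (by norm_num) hHL hHH hHB GH' Ah' AHB' ABH' E V'
        hGH' hAh' hAHB' hABH' hE hR1' hR2' R3_300_28_I z hz u hu hu0 hI hre)
    lam hclose hrelo him hpair hpairc

include hws hwt hwI hwon hamc hbf ham in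
/-- **R = 300, CLASS I: EXACTLY THE HOPF PAIR, (R1)(R2) IN ARBITRARY REAL ORTHONORMAL ORBIT BASES `e` — IMPLEMENTATION 2's cell `(300, I, 43/200, 2; 28, 29)`.** MODEL; conditional on the two certifier audits and AUDIT-BASIS. -/
theorem R300I_exactly_pair_i4_of_bases
    (vt : AbcClassI.Idx → ℂ) (hvt0 : ∀ i, i ∉ AbcClassI.cubeIdx 96 → vt i = 0)
    (hres : ∑ i ∈ AbcClassI.cubeIdx 96 ∪ (AbcClassI.cubeIdx 96).biUnion AbcClassI.nbrIdx,
      ‖(if i ∈ AbcClassI.cubeIdx 96 then (((((Row3001C.lamRe : ℚ) : ℝ) : ℂ) + (((Row3001C.lamIm : ℚ) : ℝ) : ℂ) * Complex.I) - ((-(onormSq i.1 / 300) : ℝ) : ℂ)) * vt i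
          else 0) - ∑ j ∈ AbcClassI.cubeIdx 96, amc i j * vt j‖ ^ 2 ≤ ((Row3001C.rnorm : ℚ) : ℝ) ^ 2)
    (hntb : ∑ i ∈ AbcClassI.cubeIdx 96 \ AbcClassI.cubeIdx 22, ‖vt i‖ ^ 2 ≤
      (((2315674124931519 : ℚ) / 288230376151711744 : ℚ) : ℝ) ^ 2)
    (Binv : ((↥(AbcClassI.cubeIdx 22) → ℂ) × ℂ) →ₗ[ℂ] ((↥(AbcClassI.cubeIdx 22) → ℂ) × ℂ))
    (hBinv : ∀ (c : ↥(AbcClassI.cubeIdx 22) → ℂ) (m : ℂ),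
      Binv (fun i : ↥(AbcClassI.cubeIdx 22) =>
          (((((Row3001C.lamRe : ℚ) : ℝ) : ℂ) + (((Row3001C.lamIm : ℚ) : ℝ) : ℂ) * Complex.I) - ((-(onormSq i.1.1 / 300) : ℝ) : ℂ)) * c i -
          ∑ j : ↥(AbcClassI.cubeIdx 22), amc i j * c j + m * vt i,
        ∑ i : ↥(AbcClassI.cubeIdx 22), conj (vt i) * c i) = (c, m))
    (hαM : ∀ (c : ↥(AbcClassI.cubeIdx 22) → ℂ) (g : ℂ),
      ∑ j : ↥(AbcClassI.cubeIdx 22), ‖(Binv (c, g)).1 j‖ ^ 2 + ‖(Binv (c, g)).2‖ ^ 2 ≤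
        ((Row3001C.alpha0 : ℚ) : ℝ) ^ 2 * (∑ i : ↥(AbcClassI.cubeIdx 22), ‖c i‖ ^ 2 + ‖g‖ ^ 2))
    (hβBM : ∀ w : AbcClassI.Idx → ℂ,
      ∑ j : ↥(AbcClassI.cubeIdx 22), ‖(Binv (fun i : ↥(AbcClassI.cubeIdx 22) => -∑ j ∈ AbcClassI.nbrIdx i \ AbcClassI.cubeIdx 22,
          amc i j * w j, 0)).1 j‖ ^ 2 +
        ‖(Binv (fun i : ↥(AbcClassI.cubeIdx 22) => -∑ j ∈ AbcClassI.nbrIdx i \ AbcClassI.cubeIdx 22,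
          amc i j * w j, 0)).2‖ ^ 2 ≤
        ((Row3001C.betaB : ℚ) : ℝ) ^ 2 * ∑ j ∈ (AbcClassI.cubeIdx 22).biUnion AbcClassI.nbrIdx \ AbcClassI.cubeIdx 22, ‖w j‖ ^ 2)
    (hβCM : ∀ (c : ↥(AbcClassI.cubeIdx 22) → ℂ) (g : ℂ),
      ∑ i ∈ ((AbcClassI.cubeIdx 22).biUnion AbcClassI.nbrIdx ∪ AbcClassI.cubeIdx 96) \ AbcClassI.cubeIdx 22,
        ‖-∑ j : ↥(AbcClassI.cubeIdx 22), amc i j * (Binv (c, g)).1 j +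
          (Binv (c, g)).2 * vt i‖ ^ 2 ≤
        ((Row3001C.betaC : ℚ) : ℝ) ^ 2 * (∑ i : ↥(AbcClassI.cubeIdx 22), ‖c i‖ ^ 2 + ‖g‖ ^ 2))
    (hgBM : ∀ w : AbcClassI.Idx → ℂ,
      ‖(Binv (fun i : ↥(AbcClassI.cubeIdx 22) => ∑ j ∈ AbcClassI.nbrIdx i \ AbcClassI.cubeIdx 22,
          amc i j * w j, 0)).2‖ ^ 2 ≤
        (((2617195581838679 : ℚ) / 2251799813685248 : ℚ) : ℝ) ^ 2 *
          ∑ j ∈ (AbcClassI.cubeIdx 22).biUnion AbcClassI.nbrIdx \ AbcClassI.cubeIdx 22, ‖w j‖ ^ 2)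
    (hshellM : ∀ w : AbcClassI.Idx → ℂ, (∀ i ∈ AbcClassI.cubeIdx 22, w i = 0) →
      (((5524214073445137 : ℚ) / 9007199254740992 : ℚ) : ℝ) * ∑ i ∈ AbcClassI.cubeIdx (22 + 1) \ AbcClassI.cubeIdx 22, ‖w i‖ ^ 2 ≤
        ∑ i ∈ AbcClassI.cubeIdx (22 + 1) \ AbcClassI.cubeIdx 22,
          (((((Row3001C.lamRe : ℚ) : ℝ) : ℂ) + (((Row3001C.lamIm : ℚ) : ℝ) : ℂ) * Complex.I).re - (-(onormSq i.1 / 300)) - Real.sqrt 2) * ‖w i‖ ^ 2 -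
        RCLike.re (∑ i ∈ (AbcClassI.cubeIdx 22).biUnion AbcClassI.nbrIdx \ AbcClassI.cubeIdx 22,
          conj (∑ j : ↥(AbcClassI.cubeIdx 22), amc i j *
            (Binv (fun i : ↥(AbcClassI.cubeIdx 22) => ∑ j ∈ AbcClassI.nbrIdx i \ AbcClassI.cubeIdx 22,
              amc i j * w j, 0)).1 j) * w i))
    {HL HH HB : Finset AbcClassI.Idx}
    (hHL : ∀ i : AbcClassI.Idx, i ∈ HL ↔ onormSq i.1 ≤ (28 : ℝ) ^ 2)
    (hHH : ∀ i : AbcClassI.Idx, i ∈ HH ↔ onormSq i.1 ≤ (29 : ℝ) ^ 2)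
    (hHB : ∀ i : AbcClassI.Idx, i ∈ HB ↔ (29 : ℝ) ^ 2 < onormSq i.1 ∧ onormSq i.1 ≤ ((29 : ℝ) + 1) ^ 2)
    (GH' Ah' : Matrix ↥HH ↥HH ℝ) (AHB' : Matrix ↥HH ↥HB ℝ) (ABH' : Matrix ↥HB ↥HH ℝ) (E : ↥HB → ℝ)
    (V' : Matrix ↥HH (Fin 2) ℝ) (hGH' : GH'ᵀ = GH')
    (hAh' : Ah' = Matrix.of fun i j : ↥HH =>
      (if i = j then -(onormSq i.1.1 / (300 : ℝ)) - (43 / 200 : ℝ) else 0) + am i.1 j.1)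
    (hAHB' : AHB' = Matrix.of fun (i : ↥HH) (l : ↥HB) => am i.1 l.1)
    (hABH' : ABH' = Matrix.of fun (l : ↥HB) (i : ↥HH) => am l.1 i.1)
    (hE : E = fun l : ↥HB => onormSq l.1.1 / (300 : ℝ) + (43 / 200 : ℝ) - Real.sqrt 2)
    (hR1' : ∀ x : ↥HH → ℝ, x ≠ 0 →
      x ⬝ᵥ ((GH' * Ah' + Ah'ᵀ * GH' + (1 / 2 : ℝ) • ((GH' * AHB' + ABH'ᵀ) * Matrix.diagonal (fun l => (E l)⁻¹) *
        (GH' * AHB' + ABH'ᵀ)ᵀ)) *ᵥ x) < 0)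
    (hR2' : ∀ x : ↥HH → ℝ, 0 ≤ x ⬝ᵥ ((GH' + V' * V'ᵀ) *ᵥ x)) :
    ∃ lam : ℂ, ‖lam - ((((Row3001C.lamRe : ℚ) : ℝ) : ℂ) + (((Row3001C.lamIm : ℚ) : ℝ) : ℂ) * Complex.I)‖ ≤
        ((Row3001C.rho : ℚ) : ℝ) ∧ ((Row3001C.lamRe : ℚ) : ℝ) - ((Row3001C.rho : ℚ) : ℝ) ≤ lam.re ∧ 0 < lam.im ∧
      (∃ u : UnitAddTorus (Fin 3) → EuclideanSpace ℂ (Fin 3),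
        Torus.LinNSResolventRel (1 / (2 * Real.pi * 300)) (Torus.abcFlow 1 1 1) (2 * Real.pi * lam) u 0 ∧
          u ≠ 0 ∧ IsClassI (mFourierCoeff u)) ∧
      (∃ u : UnitAddTorus (Fin 3) → EuclideanSpace ℂ (Fin 3),
        Torus.LinNSResolventRel (1 / (2 * Real.pi * 300)) (Torus.abcFlow 1 1 1) (2 * Real.pi * conj lam) u 0 ∧
          u ≠ 0 ∧ IsClassI (mFourierCoeff u)) ∧
      ∀ (z : ℂ) (u : UnitAddTorus (Fin 3) → EuclideanSpace ℂ (Fin 3)),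
        Torus.LinNSResolventRel (1 / (2 * Real.pi * 300)) (Torus.abcFlow 1 1 1) (2 * Real.pi * z) u 0 → u ≠ 0 →
          IsClassI (mFourierCoeff u) → (43 / 200 : ℝ) ≤ z.re → z = lam ∨ z = conj lam := by
  obtain ⟨lam, hclose, hrelo, -, him, hpair, hpairc, -, -⟩ :=
    AbcClassIEigenpair.row3001C_classI_eigenpairs_of_complex_bases wf hws hwt hwI hwon amc hamc vt hvt0 hres hntb
      Binv hBinv hαM hβBM hβCM hgBM hshellM
  exact exactly_pair_of_row_of_cell (a := 43 / 200) a_le_row3001C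
    (fun z hz u hu hu0 hI hre =>
      card_classI_eigenfunctions_le_of_inertia_certificate_of_bases e bf hbf am ham (R := 300) (a := 43 / 200)
        (rL := 28) (rH := 29) (m := 2) (by norm_num) (by norm_num) (by norm_num) hHL hHH hHB GH' Ah' AHB' ABH' E V'
        hGH' hAh' hAHB' hABH' hE hR1' hR2' R3_300_29_I z hz u hu hu0 hI hre)
    lam hclose hrelo him hpair hpairc

include hws hwt hwI hwon hamc hbf ham in
/-- **R = 500, CLASS I: EXACTLY THE HOPF PAIR, (R1)(R2) IN ARBITRARY REAL ORTHONORMAL ORBIT BASES `e` — IMPLEMENTATION 2's cell `(500, I, 1/4, 2; 36, 37)`** (the T2 row `Row5001C` in the complex orbit bases `wf`). MODEL; conditional on the two certifier audits and AUDIT-BASIS. -/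
theorem R500I_exactly_pair_i4_of_bases
    (vt : AbcClassI.Idx → ℂ) (hvt0 : ∀ i, i ∉ AbcClassI.cubeIdx 112 → vt i = 0)
    (hres : ∑ i ∈ AbcClassI.cubeIdx 112 ∪ (AbcClassI.cubeIdx 112).biUnion AbcClassI.nbrIdx,
      ‖(if i ∈ AbcClassI.cubeIdx 112 then (((((Row5001C.lamRe : ℚ) : ℝ) : ℂ) + (((Row5001C.lamIm : ℚ) : ℝ) : ℂ) * Complex.I) - ((-(onormSq i.1 / 500) : ℝ) : ℂ)) * vt i
          else 0) - ∑ j ∈ AbcClassI.cubeIdx 112, amc i j * vt j‖ ^ 2 ≤ ((Row5001C.rnorm : ℚ) : ℝ) ^ 2)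
    (hntb : ∑ i ∈ AbcClassI.cubeIdx 112 \ AbcClassI.cubeIdx 28, ‖vt i‖ ^ 2 ≤
      (((8161754834082577 : ℚ) / 1152921504606846976 : ℚ) : ℝ) ^ 2)
    (Binv : ((↥(AbcClassI.cubeIdx 28) → ℂ) × ℂ) →ₗ[ℂ] ((↥(AbcClassI.cubeIdx 28) → ℂ) × ℂ))
    (hBinv : ∀ (c : ↥(AbcClassI.cubeIdx 28) → ℂ) (m : ℂ),
      Binv (fun i : ↥(AbcClassI.cubeIdx 28) =>
          (((((Row5001C.lamRe : ℚ) : ℝ) : ℂ) + (((Row5001C.lamIm : ℚ) : ℝ) : ℂ) * Complex.I) - ((-(onormSq i.1.1 / 500) : ℝ) : ℂ)) * c i -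
          ∑ j : ↥(AbcClassI.cubeIdx 28), amc i j * c j + m * vt i,
        ∑ i : ↥(AbcClassI.cubeIdx 28), conj (vt i) * c i) = (c, m))
    (hαM : ∀ (c : ↥(AbcClassI.cubeIdx 28) → ℂ) (g : ℂ),
      ∑ j : ↥(AbcClassI.cubeIdx 28), ‖(Binv (c, g)).1 j‖ ^ 2 + ‖(Binv (c, g)).2‖ ^ 2 ≤
        ((Row5001C.alpha0 : ℚ) : ℝ) ^ 2 * (∑ i : ↥(AbcClassI.cubeIdx 28), ‖c i‖ ^ 2 + ‖g‖ ^ 2))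
    (hβBM : ∀ w : AbcClassI.Idx → ℂ,
      ∑ j : ↥(AbcClassI.cubeIdx 28), ‖(Binv (fun i : ↥(AbcClassI.cubeIdx 28) => -∑ j ∈ AbcClassI.nbrIdx i \ AbcClassI.cubeIdx 28,
          amc i j * w j, 0)).1 j‖ ^ 2 +
        ‖(Binv (fun i : ↥(AbcClassI.cubeIdx 28) => -∑ j ∈ AbcClassI.nbrIdx i \ AbcClassI.cubeIdx 28,
          amc i j * w j, 0)).2‖ ^ 2 ≤
        ((Row5001C.betaB : ℚ) : ℝ) ^ 2 * ∑ j ∈ (AbcClassI.cubeIdx 28).biUnion AbcClassI.nbrIdx \ AbcClassI.cubeIdx 28, ‖w j‖ ^ 2)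
    (hβCM : ∀ (c : ↥(AbcClassI.cubeIdx 28) → ℂ) (g : ℂ),
      ∑ i ∈ ((AbcClassI.cubeIdx 28).biUnion AbcClassI.nbrIdx ∪ AbcClassI.cubeIdx 112) \ AbcClassI.cubeIdx 28,
        ‖-∑ j : ↥(AbcClassI.cubeIdx 28), amc i j * (Binv (c, g)).1 j +
          (Binv (c, g)).2 * vt i‖ ^ 2 ≤
        ((Row5001C.betaC : ℚ) : ℝ) ^ 2 * (∑ i : ↥(AbcClassI.cubeIdx 28), ‖c i‖ ^ 2 + ‖g‖ ^ 2))
    (hgBM : ∀ w : AbcClassI.Idx → ℂ,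
      ‖(Binv (fun i : ↥(AbcClassI.cubeIdx 28) => ∑ j ∈ AbcClassI.nbrIdx i \ AbcClassI.cubeIdx 28,
          amc i j * w j, 0)).2‖ ^ 2 ≤
        (((3449790300190025 : ℚ) / 2251799813685248 : ℚ) : ℝ) ^ 2 *
          ∑ j ∈ (AbcClassI.cubeIdx 28).biUnion AbcClassI.nbrIdx \ AbcClassI.cubeIdx 28, ‖w j‖ ^ 2)
    (hshellM : ∀ w : AbcClassI.Idx → ℂ, (∀ i ∈ AbcClassI.cubeIdx 28, w i = 0) →
      (((4982293683959657 : ℚ) / 9007199254740992 : ℚ) : ℝ) * ∑ i ∈ AbcClassI.cubeIdx (28 + 1) \ AbcClassI.cubeIdx 28, ‖w i‖ ^ 2 ≤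
        ∑ i ∈ AbcClassI.cubeIdx (28 + 1) \ AbcClassI.cubeIdx 28,
          (((((Row5001C.lamRe : ℚ) : ℝ) : ℂ) + (((Row5001C.lamIm : ℚ) : ℝ) : ℂ) * Complex.I).re - (-(onormSq i.1 / 500)) - Real.sqrt 2) * ‖w i‖ ^ 2 -
        RCLike.re (∑ i ∈ (AbcClassI.cubeIdx 28).biUnion AbcClassI.nbrIdx \ AbcClassI.cubeIdx 28,
          conj (∑ j : ↥(AbcClassI.cubeIdx 28), amc i j *
            (Binv (fun i : ↥(AbcClassI.cubeIdx 28) => ∑ j ∈ AbcClassI.nbrIdx i \ AbcClassI.cubeIdx 28,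
              amc i j * w j, 0)).1 j) * w i))
    {HL HH HB : Finset AbcClassI.Idx}
    (hHL : ∀ i : AbcClassI.Idx, i ∈ HL ↔ onormSq i.1 ≤ (36 : ℝ) ^ 2)
    (hHH : ∀ i : AbcClassI.Idx, i ∈ HH ↔ onormSq i.1 ≤ (37 : ℝ) ^ 2)
    (hHB : ∀ i : AbcClassI.Idx, i ∈ HB ↔ (37 : ℝ) ^ 2 < onormSq i.1 ∧ onormSq i.1 ≤ ((37 : ℝ) + 1) ^ 2)
    (GH' Ah' : Matrix ↥HH ↥HH ℝ) (AHB' : Matrix ↥HH ↥HB ℝ) (ABH' : Matrix ↥HB ↥HH ℝ) (E : ↥HB → ℝ)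
    (V' : Matrix ↥HH (Fin 2) ℝ) (hGH' : GH'ᵀ = GH')
    (hAh' : Ah' = Matrix.of fun i j : ↥HH =>
      (if i = j then -(onormSq i.1.1 / (500 : ℝ)) - (1 / 4 : ℝ) else 0) + am i.1 j.1)
    (hAHB' : AHB' = Matrix.of fun (i : ↥HH) (l : ↥HB) => am i.1 l.1)
    (hABH' : ABH' = Matrix.of fun (l : ↥HB) (i : ↥HH) => am l.1 i.1)
    (hE : E = fun l : ↥HB => onormSq l.1.1 / (500 : ℝ) + (1 / 4 : ℝ) - Real.sqrt 2)
    (hR1' : ∀ x : ↥HH → ℝ, x ≠ 0 →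
      x ⬝ᵥ ((GH' * Ah' + Ah'ᵀ * GH' + (1 / 2 : ℝ) • ((GH' * AHB' + ABH'ᵀ) * Matrix.diagonal (fun l => (E l)⁻¹) *
        (GH' * AHB' + ABH'ᵀ)ᵀ)) *ᵥ x) < 0)
    (hR2' : ∀ x : ↥HH → ℝ, 0 ≤ x ⬝ᵥ ((GH' + V' * V'ᵀ) *ᵥ x)) :
    ∃ lam : ℂ, ‖lam - ((((Row5001C.lamRe : ℚ) : ℝ) : ℂ) + (((Row5001C.lamIm : ℚ) : ℝ) : ℂ) * Complex.I)‖ ≤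
        ((Row5001C.rho : ℚ) : ℝ) ∧ ((Row5001C.lamRe : ℚ) : ℝ) - ((Row5001C.rho : ℚ) : ℝ) ≤ lam.re ∧ 0 < lam.im ∧
      (∃ u : UnitAddTorus (Fin 3) → EuclideanSpace ℂ (Fin 3),
        Torus.LinNSResolventRel (1 / (2 * Real.pi * 500)) (Torus.abcFlow 1 1 1) (2 * Real.pi * lam) u 0 ∧
          u ≠ 0 ∧ IsClassI (mFourierCoeff u)) ∧
      (∃ u : UnitAddTorus (Fin 3) → EuclideanSpace ℂ (Fin 3),
        Torus.LinNSResolventRel (1 / (2 * Real.pi * 500)) (Torus.abcFlow 1 1 1) (2 * Real.pi * conj lam) u 0 ∧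
          u ≠ 0 ∧ IsClassI (mFourierCoeff u)) ∧
      ∀ (z : ℂ) (u : UnitAddTorus (Fin 3) → EuclideanSpace ℂ (Fin 3)),
        Torus.LinNSResolventRel (1 / (2 * Real.pi * 500)) (Torus.abcFlow 1 1 1) (2 * Real.pi * z) u 0 → u ≠ 0 →
          IsClassI (mFourierCoeff u) → (1 / 4 : ℝ) ≤ z.re → z = lam ∨ z = conj lam := by
  obtain ⟨lam, hclose, hrelo, -, him, hpair, hpairc, -, -⟩ :=
    AbcClassIEigenpair.row5001C_classI_eigenpairs_of_complex_bases wf hws hwt hwI hwon amc hamc vt hvt0 hres hntb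
      Binv hBinv hαM hβBM hβCM hgBM hshellM
  exact exactly_pair_of_row_of_cell (a := 1 / 4) a_le_row5001C
    (fun z hz u hu hu0 hI hre =>
      card_classI_eigenfunctions_le_of_inertia_certificate_of_bases e bf hbf am ham (R := 500) (a := 1 / 4)
        (rL := 36) (rH := 37) (m := 2) (by norm_num) (by norm_num) (by norm_num) hHL hHH hHB GH' Ah' AHB' ABH' E V'
        hGH' hAh' hAHB' hABH' hE hR1' hR2' R3_500_37_I z hz u hu hu0 hI hre)
    lam hclose hrelo him hpair hpairc

end Row

end Summit.NavierStokesRegularity.FluidComputer.AbcInertiaCI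

end
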